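import Literature.Probability.NegativeDependence.AlmostExchangeableSequences
import Literature.Probability.NegativeDependence.ExchangeableRayleigh
import Literature.Probability.NegativeDependence.WeightInversion
import HarnessLib

/-!
# Almost exchangeable measures: Rayleigh ⟺ (i) + (ii) (Borcea–Brändén–Liggett, Proposition 6.2)

J. Borcea, P. Brändén, T. M. Liggett, *Negative dependence and the geometry of polynomials*, J. Amer. Math. Soc.
22 (2009) 521–567 (arXiv:0707.2340, held `paper:arxiv-0707.2340`), §6. Verbatim:

> **Proposition 6.2.** Let `μ ∈ 𝔓_{n+1}` be such that its generating polynomial `g = g_μ` is symmetric in its first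
> `n` variables, so that `g(z_1,…,z_{n+1}) = z_{n+1} Σ_{k=0}^n a_k e_k(z_1,…,z_n) + Σ_{k=0}^n b_k e_k(z_1,…,z_n)`.
> Then `μ` is Rayleigh if and only if (i) `{θ a_k + (1-θ) b_k}_{k=0}^n` is LC for all `0 ≤ θ ≤ 1`, and
> (ii) `a_k b_{k+1} ≥ a_{k+1} b_k` for all `0 ≤ k ≤ n-1`.
> *Proof.* Suppose first that `μ` is Rayleigh. By Proposition 2.1 we get that if `0 ≤ θ < 1` then
> `g(z_1,…,z_n,θ/(1-θ))` is a Rayleigh polynomial that is symmetric in all its `n` variables. Condition (i) now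
> follows from the exchangeable case (Theorem 3.7). Let `S ⊆ [n-1]` be of cardinality `i`. The NLC condition gives
> `a_i b_{i+1} = μ(S ∪ {n+1}) μ(S ∪ {n}) ≥ μ(S ∪ {n,n+1}) μ(S) = a_{i+1} b_i`, which verifies (ii).
> Assume now that `{a_k}` and `{b_k}` satisfy (i) and (ii). The inequality [for `i, j ∈ [n]`] follows from the
> exchangeable case and (i). What is left to prove is the inequality [for the pair `i, n+1`], and by symmetry (in
> the first `n` variables) we only need to check it for e.g. `i = n`. We may write `g` as
> `Σ b_k e_k(z_1,…,z_{n-1}) + z_n Σ b_{k+1} e_k(…) + z_{n+1} Σ a_k e_k(…) + z_n z_{n+1} Σ a_{k+1} e_k(…)`, so the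
> desired inequality is equivalent to `(Σ_j a_j e_j)(Σ_j b_{j+1} e_j) - (Σ_j a_{j+1} e_j)(Σ_j b_j e_j) ≥ 0` for all
> `x ∈ ℝ_+^{n-1}` […] [`C` is `TP₂`, `E` is `TP₂`, Cauchy–Binet; tree `AlmostExchangeableSequences.lean`]. □

## Transposition

* The `n+1` variables are indexed by `Option τ` (`|τ| = n`), the distinguished variable `z_{n+1}` being `none`;
  the weight is `almostExch a b : U ↦ a(|U ∖ {none}|)` if `none ∈ U`, else `b(|U|)`, for profiles
  `a, b : ℕ → ℝ` (in the "only if" direction assumed to vanish above `n`). "LC" = `IsLogConcaveSeq` (nonnegative,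
  log-concave, no internal zeros; `LogConcaveSequences.lean`), Rayleigh = `IsRayleigh` (`RayleighMeasures.lean`).
* `g(z_1,…,z_n, t)`: the specialization `specNone t μ : S ↦ μ(S) + t μ(S ∪ {none})` on `Finset τ`;
  `eval_multiAffine_option`, `specNone_derivWeight_some` give `Δ_{ij}(g)(x) = Δ_{ij}(g(·, x_{n+1}))(x|_τ)` for
  `i, j ≤ n` (`eval_rayleighDiff_some_some`), and `specNone t (almostExch a b)` has the profile `b + t a`
  (= `(1+t)(θ a + (1-θ) b)`, `θ = t/(1+t)`), which is handled by the tree's exchangeable case `isRayleigh_card`.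
* The pair `(n, n+1)`: `Δ = A_0 B_1 - A_1 B_0` in the weight form `Δ_{ij} = bc - ad`
  (`eval_rayleighDiff_multiAffine_eq_of_ne`), the four blocks being `Σ_k c_k e_k(x')` over the remaining variables
  (`eval_multiAffine_freeW`), and the sign is `cauchyBinet_two_nonneg` with `tp2_of_lc` and `isLogConcaveSeq_esymmVal`.

## Contents

* §1 `almostExch`, `specNone`, `sum_finset_option`, `eval_multiAffine_option`, `specNone_derivWeight_some`,
  `eval_rayleighDiff_some_some`, `specNone_almostExch`.
* §2 the blocks: `freeW`, `eval_multiAffine_freeW`, the four identifications, `eval_rayleighDiff_none_some_almostExch`.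
* §3 **`isRayleigh_almostExch`** (Prop. 6.2, "if"), **`BorceaBrandenLiggett_prop_6_2_onlyIf`** ((i) and (ii) from
  Rayleigh), **`BorceaBrandenLiggett_prop_6_2`** (iff).

## References

* [BorceaBrandenLiggett2007] J. Borcea, P. Brändén, T. M. Liggett, Negative dependence and the geometry of
  polynomials, J. Amer. Math. Soc. 22 (2009); arXiv:0707.2340 — §6 Prop. 6.2 and its proof; §2.1 Prop. 2.1,
  Prop. 2.2; §3 Thm. 3.7.
* [Pemantle2000] R. Pemantle, Towards a theory of negative dependence — Thm. 2.7 (the exchangeable case).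
-/

noncomputable section

open Finset MvPolynomial
open Literature.Probability.Distributions
open Literature.Combinatorics.Sahi2008
open Literature.Combinatorics.StablePolynomials

namespace Literature.Probability.NegativeDependence

variable {τ : Type*} [Fintype τ] [DecidableEq τ]

/-! ## §1 The almost exchangeable weight and the specialization `z_{n+1} = t` -/

section Weight

/-- **The almost exchangeable weight** with profiles `a` (sets containing the distinguished coordinate `none`)
and `b` (sets avoiding it): generating polynomial `z_{n+1} Σ_k a_k e_k(z) + Σ_k b_k e_k(z)`.
[cite: BorceaBrandenLiggett2007, §6 Prop. 6.2 ("`g` is symmetric in its first `n` variables")] -/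
def almostExch (a b : ℕ → ℝ) : Finset (Option τ) → ℝ := fun U =>
  if none ∈ U then a U.eraseNone.card else b U.eraseNone.card

omit [Fintype τ] in
/-- Unfolding `almostExch`. [cite: BorceaBrandenLiggett2007, §6 Prop. 6.2] -/
theorem almostExch_apply (a b : ℕ → ℝ) (U : Finset (Option τ)) :
    almostExch a b U = if none ∈ U then a U.eraseNone.card else b U.eraseNone.card := rfl

omit [Fintype τ] in
/-- Nonnegative profiles give a nonnegative weight. [cite: BorceaBrandenLiggett2007, §6 Prop. 6.2] -/
theorem almostExch_nonneg {a b : ℕ → ℝ} (ha : ∀ k, 0 ≤ a k) (hb : ∀ k, 0 ≤ b k) (U : Finset (Option τ)) :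
    0 ≤ almostExch a b U := by
  rw [almostExch_apply]; split_ifs; exacts [ha _, hb _]

/-- **Specialization `z_{n+1} = t`** of a weight on `2^{τ ⊔ {∗}}`: `S ↦ μ(S) + t μ(S ∪ {∗})`, the coefficient weight
of `g(z_1,…,z_n,t)`. [cite: BorceaBrandenLiggett2007, §6 proof of Prop. 6.2 ("`g(z_1,…,z_n,θ/(1-θ))`")] -/
def specNone (t : ℝ) (μ : Finset (Option τ) → ℝ) : Finset τ → ℝ := fun S =>
  μ (S.map Function.Embedding.some) + t * μ (insert none (S.map Function.Embedding.some))

omit [Fintype τ] in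
/-- Unfolding `specNone`. [cite: BorceaBrandenLiggett2007, §6 proof of Prop. 6.2] -/
theorem specNone_apply (t : ℝ) (μ : Finset (Option τ) → ℝ) (S : Finset τ) :
    specNone t μ S = μ (S.map Function.Embedding.some) + t * μ (insert none (S.map Function.Embedding.some)) := rfl

omit [Fintype τ] [DecidableEq τ] in
/-- `eraseNone` ignores `none`. [cite: BorceaBrandenLiggett2007, §6 Prop. 6.2] -/
theorem eraseNone_insert_none (V : Finset (Option τ)) [DecidableEq (Option τ)] :
    (insert none V).eraseNone = V.eraseNone := by
  ext x
  simp [Finset.mem_eraseNone]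

/-- **Splitting `2^{τ ⊔ {∗}}` along `∗`**: `Σ_U F(U) = Σ_{S ⊆ τ} (F(S) + F(S ∪ {∗}))`.
[cite: BorceaBrandenLiggett2007, §6 proof of Prop. 6.2 ("We may write `g` as …")] -/
theorem sum_finset_option (F : Finset (Option τ) → ℝ) :
    ∑ U : Finset (Option τ), F U =
      ∑ S : Finset τ, (F (S.map Function.Embedding.some) + F (insert none (S.map Function.Embedding.some))) := by
  rw [Finset.sum_add_distrib, ← Finset.sum_filter_add_sum_filter_not Finset.univ (fun U : Finset (Option τ) => none ∈ U),
    add_comm]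
  congr 1
  · refine Finset.sum_bij' (fun U _ => U.eraseNone) (fun S _ => S.map Function.Embedding.some) (fun U hU => ?_)
      (fun S hS => ?_) (fun U hU => ?_) (fun S hS => ?_) (fun U hU => ?_)
    · exact Finset.mem_univ _
    · rw [Finset.mem_filter]
      refine ⟨Finset.mem_univ _, fun h => ?_⟩
      obtain ⟨x, _, hx⟩ := Finset.mem_map.1 h
      exact Option.some_ne_none x hx
    · have hU' : none ∉ U := (Finset.mem_filter.1 hU).2
      rw [Finset.map_some_eraseNone, Finset.erase_eq_of_notMem hU']
    · exact Finset.eraseNone_map_some S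
    · have hU' : none ∉ U := (Finset.mem_filter.1 hU).2
      rw [Finset.map_some_eraseNone, Finset.erase_eq_of_notMem hU']
  · refine Finset.sum_bij' (fun U _ => U.eraseNone) (fun S _ => insert none (S.map Function.Embedding.some))
      (fun U hU => ?_) (fun S hS => ?_) (fun U hU => ?_) (fun S hS => ?_) (fun U hU => ?_)
    · exact Finset.mem_univ _
    · rw [Finset.mem_filter]
      exact ⟨Finset.mem_univ _, Finset.mem_insert_self _ _⟩
    · have hU' : none ∈ U := (Finset.mem_filter.1 hU).2
      rw [Finset.map_some_eraseNone, Finset.insert_erase hU']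
    · rw [eraseNone_insert_none, Finset.eraseNone_map_some]
    · have hU' : none ∈ U := (Finset.mem_filter.1 hU).2
      rw [Finset.map_some_eraseNone, Finset.insert_erase hU']

/-- **`g(x) = g(·, x_{n+1})(x|_τ)`**: the generating polynomial at `x` is that of the specialization at `x ∘ some`.
[cite: BorceaBrandenLiggett2007, §6 proof of Prop. 6.2] -/
theorem eval_multiAffine_option (μ : Finset (Option τ) → ℝ) (x : Option τ → ℝ) :
    MvPolynomial.eval x (multiAffine μ) =
      MvPolynomial.eval (fun i => x (some i)) (multiAffine (specNone (x none) μ)) := by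
  rw [eval_multiAffine, eval_multiAffine, sum_finset_option]
  refine Finset.sum_congr rfl fun S _ => ?_
  have hnone : (none : Option τ) ∉ S.map Function.Embedding.some := fun h => by
    obtain ⟨y, _, hy⟩ := Finset.mem_map.1 h
    exact Option.some_ne_none y hy
  rw [specNone_apply, Finset.prod_insert hnone, Finset.prod_map]
  simp only [Function.Embedding.some_apply]
  ring

omit [Fintype τ] in
/-- `∂_i` (`i ≤ n`) commutes with the specialization `z_{n+1} = t`. [cite: BorceaBrandenLiggett2007, §6 proof of
Prop. 6.2] -/
theorem specNone_derivWeight_some (t : ℝ) (μ : Finset (Option τ) → ℝ) (p : τ) :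
    specNone t (derivWeight (some p) μ) = derivWeight p (specNone t μ) := by
  funext S
  rw [specNone_apply, derivWeight_apply, derivWeight_apply, derivWeight_apply, specNone_apply]
  by_cases hp : p ∈ S
  · have h1 : some p ∈ S.map Function.Embedding.some := (Finset.mem_map' _).2 hp
    rw [if_pos h1, if_pos (Finset.mem_insert_of_mem h1), if_pos hp, mul_zero, add_zero]
  · have h1 : some p ∉ S.map Function.Embedding.some := fun h => hp ((Finset.mem_map' _).1 h)
    have h2 : some p ∉ insert none (S.map Function.Embedding.some) := by
      rw [Finset.mem_insert, not_or]; exact ⟨Option.some_ne_none p, h1⟩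
    rw [if_neg h1, if_neg h2, if_neg hp, Finset.map_insert, Function.Embedding.some_apply, Finset.insert_comm]

/-- **`Δ_{ij}(g)(x) = Δ_{ij}(g(·,x_{n+1}))(x|_τ)` for `i, j ≤ n`.** [cite: BorceaBrandenLiggett2007, §6 proof of
Prop. 6.2 ("follows from the exchangeable case and (i)")] -/
theorem eval_rayleighDiff_some_some (μ : Finset (Option τ) → ℝ) (x : Option τ → ℝ) (p q : τ) :
    MvPolynomial.eval x (rayleighDiff (some p) (some q) (multiAffine μ)) =
      MvPolynomial.eval (fun i => x (some i)) (rayleighDiff p q (multiAffine (specNone (x none) μ))) := by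
  rw [eval_rayleighDiff_multiAffine, eval_rayleighDiff_multiAffine, eval_multiAffine_option, eval_multiAffine_option,
    eval_multiAffine_option (derivWeight (some p) (derivWeight (some q) μ)), eval_multiAffine_option μ,
    specNone_derivWeight_some, specNone_derivWeight_some, specNone_derivWeight_some, specNone_derivWeight_some]

omit [Fintype τ] in
/-- The specialization of the almost exchangeable weight is exchangeable with profile `b + t a`.
[cite: BorceaBrandenLiggett2007, §6 proof of Prop. 6.2 ("`g(z_1,…,z_n,θ/(1-θ))` … symmetric in all its `n`
variables")] -/
theorem specNone_almostExch (t : ℝ) (a b : ℕ → ℝ) :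
    specNone t (almostExch a b : Finset (Option τ) → ℝ) = fun S => b S.card + t * a S.card := by
  funext S
  have hnone : (none : Option τ) ∉ S.map Function.Embedding.some := fun h => by
    obtain ⟨y, _, hy⟩ := Finset.mem_map.1 h
    exact Option.some_ne_none y hy
  rw [specNone_apply, almostExch_apply, almostExch_apply, if_neg hnone, if_pos (Finset.mem_insert_self _ _),
    eraseNone_insert_none, Finset.eraseNone_map_some]

/-- Condition (i) at `θ = t/(1+t)`: the profile `b + t a` is `PF₂` for `t ≥ 0`. [cite: BorceaBrandenLiggett2007,
§6 proof of Prop. 6.2] -/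
theorem isLogConcaveSeq_add_mul_of_convex {a b : ℕ → ℝ}
    (hi : ∀ θ : ℝ, 0 ≤ θ → θ ≤ 1 → IsLogConcaveSeq fun k => θ * a k + (1 - θ) * b k) {t : ℝ} (ht : 0 ≤ t) :
    IsLogConcaveSeq fun k => b k + t * a k := by
  have h1t : 0 < 1 + t := by linarith
  have key := (hi (t / (1 + t)) (div_nonneg ht h1t.le) ((div_le_one h1t).2 (by linarith))).const_mul h1t.le
  have heq : (fun k => (1 + t) * (t / (1 + t) * a k + (1 - t / (1 + t)) * b k)) = fun k => b k + t * a k := by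
    funext k
    field_simp
    ring
  rwa [heq] at key

end Weight

/-! ## §2 The four blocks of `Δ_{n+1,n}` -/

section Blocks

/-- The weight `U ↦ c(|U|)` on the sets avoiding `none` and `some p` (the coefficients `Σ_k c_k e_k(z')` in the
remaining `n - 1` variables). [cite: BorceaBrandenLiggett2007, §6 proof of Prop. 6.2 (`e_j = e_j(x_1,…,x_{n-1})`)] -/
def freeW (p : τ) (c : ℕ → ℝ) : Finset (Option τ) → ℝ := fun U => if none ∈ U ∨ some p ∈ U then 0 else c U.card

omit [Fintype τ] in
/-- Unfolding `freeW`. [cite: BorceaBrandenLiggett2007, §6 proof of Prop. 6.2] -/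
theorem freeW_apply (p : τ) (c : ℕ → ℝ) (U : Finset (Option τ)) :
    freeW p c U = if none ∈ U ∨ some p ∈ U then 0 else c U.card := rfl

/-- **`Σ_U freeW(U) x^U = Σ_{k=0}^{n} c_k e_k(x')`**, `x' = x ∘ some` on `τ ∖ {p}`.
[cite: BorceaBrandenLiggett2007, §6 proof of Prop. 6.2] -/
theorem eval_multiAffine_freeW (p : τ) (c : ℕ → ℝ) (x : Option τ → ℝ) :
    MvPolynomial.eval x (multiAffine (freeW p c)) =
      ∑ k ∈ range (Fintype.card τ + 1),
        c k * ∑ W ∈ (Finset.univ.erase p).powersetCard k, ∏ j ∈ W, x (some j) := by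
  rw [eval_multiAffine]
  -- only `U = W.map some`, `W ⊆ τ ∖ {p}`, contribute
  have step1 : ∑ U : Finset (Option τ), freeW p c U * ∏ u ∈ U, x u =
      ∑ W ∈ (Finset.univ.erase p).powerset, c W.card * ∏ j ∈ W, x (some j) := by
    rw [← Finset.sum_filter_of_ne (p := fun U : Finset (Option τ) => ¬ (none ∈ U ∨ some p ∈ U))
      (fun U _ hU => by rw [freeW_apply] at hU; intro h; exact hU (by rw [if_pos h, zero_mul]))]
    refine Finset.sum_bij' (fun U _ => U.eraseNone) (fun W _ => W.map Function.Embedding.some) (fun U hU => ?_)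
      (fun W hW => ?_) (fun U hU => ?_) (fun W hW => ?_) (fun U hU => ?_)
    · have hU' := (Finset.mem_filter.1 hU).2
      rw [not_or] at hU'
      rw [Finset.mem_powerset]
      intro y hy
      rw [Finset.mem_erase]
      refine ⟨fun h => hU'.2 ?_, Finset.mem_univ _⟩
      rw [← h]; exact Finset.mem_eraseNone.1 hy
    · rw [Finset.mem_powerset] at hW
      rw [Finset.mem_filter, not_or]
      refine ⟨Finset.mem_univ _, fun h => ?_, fun h => ?_⟩
      · obtain ⟨y, _, hy⟩ := Finset.mem_map.1 h
        exact Option.some_ne_none y hy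
      · exact (Finset.mem_erase.1 (hW ((Finset.mem_map' _).1 h))).1 rfl
    · have hU' := (Finset.mem_filter.1 hU).2
      rw [not_or] at hU'
      rw [Finset.map_some_eraseNone, Finset.erase_eq_of_notMem hU'.1]
    · exact Finset.eraseNone_map_some W
    · have hU' := (Finset.mem_filter.1 hU).2
      have hnone : none ∉ U := fun h => hU' (Or.inl h)
      rw [freeW_apply, if_neg hU', Finset.card_eraseNone_of_not_mem hnone]
      congr 1
      conv_lhs => rw [← Finset.erase_eq_of_notMem hnone, ← Finset.map_some_eraseNone, Finset.prod_map]
      rfl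
  rw [step1, Finset.powerset_card_disjiUnion, Finset.sum_disjiUnion]
  have hcard : (Finset.univ.erase p).card + 1 = Fintype.card τ := by
    rw [Finset.card_erase_of_mem (Finset.mem_univ p), Finset.card_univ]
    have := Fintype.card_pos_iff.2 ⟨p⟩
    omega
  rw [hcard, Finset.sum_range_succ, esymmVal_eq_zero_of_card_lt _ _ (by rw [← hcard]; exact Nat.lt_succ_self _),
    mul_zero, add_zero]
  refine Finset.sum_congr rfl fun k _ => ?_
  rw [Finset.mul_sum]
  exact Finset.sum_congr rfl fun W hW => by rw [(Finset.mem_powersetCard.1 hW).2]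

omit [Fintype τ] in
/-- `A_0`: the block `(μ|_{z_n = 0})` differentiated in `z_{n+1}` has profile `a`. [cite: BorceaBrandenLiggett2007,
§6 proof of Prop. 6.2 ("`z_{n+1} Σ a_k e_k`")] -/
theorem pinOut_some_derivWeight_none_almostExch (a b : ℕ → ℝ) (p : τ) :
    pinOut (some p) (derivWeight none (almostExch a b : Finset (Option τ) → ℝ)) = freeW p a := by
  funext U
  rw [pinOut_apply, derivWeight_apply, almostExch_apply, freeW_apply]
  by_cases hp : some p ∈ U
  · rw [if_pos hp, if_pos (Or.inr hp)]
  · rw [if_neg hp]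
    by_cases hn : none ∈ U
    · rw [if_pos hn, if_pos (Or.inl hn)]
    · rw [if_neg hn, if_pos (Finset.mem_insert_self _ _), if_neg (by rw [not_or]; exact ⟨hn, hp⟩),
        eraseNone_insert_none, Finset.card_eraseNone_of_not_mem hn]

omit [Fintype τ] in
/-- `B_1`: the block of `z_n` (avoiding `z_{n+1}`) has profile `k ↦ b_{k+1}`. [cite: BorceaBrandenLiggett2007, §6
proof of Prop. 6.2 ("`z_n Σ b_{k+1} e_k`")] -/
theorem pinOut_none_derivWeight_some_almostExch (a b : ℕ → ℝ) (p : τ) :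
    pinOut none (derivWeight (some p) (almostExch a b : Finset (Option τ) → ℝ)) = freeW p fun k => b (k + 1) := by
  funext U
  rw [pinOut_apply, derivWeight_apply, almostExch_apply, freeW_apply]
  by_cases hn : none ∈ U
  · rw [if_pos hn, if_pos (Or.inl hn)]
  · rw [if_neg hn]
    by_cases hp : some p ∈ U
    · rw [if_pos hp, if_pos (Or.inr hp)]
    · have hn' : none ∉ insert (some p) U := by
        rw [Finset.mem_insert, not_or]; exact ⟨fun h => Option.some_ne_none p h.symm, hn⟩
      rw [if_neg hp, if_neg hn', if_neg (by rw [not_or]; exact ⟨hn, hp⟩), Finset.card_eraseNone_of_not_mem hn',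
        Finset.card_insert_of_notMem hp]

omit [Fintype τ] in
/-- `A_1`: the block of `z_n z_{n+1}` has profile `k ↦ a_{k+1}`. [cite: BorceaBrandenLiggett2007, §6 proof of
Prop. 6.2 ("`z_n z_{n+1} Σ a_{k+1} e_k`")] -/
theorem derivWeight_none_derivWeight_some_almostExch (a b : ℕ → ℝ) (p : τ) :
    derivWeight none (derivWeight (some p) (almostExch a b : Finset (Option τ) → ℝ)) = freeW p fun k => a (k + 1) := by
  funext U
  rw [derivWeight_apply, derivWeight_apply, almostExch_apply, freeW_apply]
  by_cases hn : none ∈ U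
  · rw [if_pos hn, if_pos (Or.inl hn)]
  · rw [if_neg hn]
    by_cases hp : some p ∈ U
    · rw [if_pos (Finset.mem_insert_of_mem hp), if_pos (Or.inr hp)]
    · have hp' : some p ∉ insert none U := by
        rw [Finset.mem_insert, not_or]; exact ⟨Option.some_ne_none p, hp⟩
      rw [if_neg hp', if_pos (Finset.mem_insert_of_mem (Finset.mem_insert_self _ _)),
        if_neg (by rw [not_or]; exact ⟨hn, hp⟩), Finset.insert_comm, eraseNone_insert_none,
        Finset.card_eraseNone_of_not_mem (show none ∉ insert (some p) U by
          rw [Finset.mem_insert, not_or]; exact ⟨fun h => Option.some_ne_none p h.symm, hn⟩),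
        Finset.card_insert_of_notMem hp]

omit [Fintype τ] in
/-- `B_0`: the block avoiding `z_n, z_{n+1}` has profile `b`. [cite: BorceaBrandenLiggett2007, §6 proof of Prop. 6.2
("`Σ b_k e_k`")] -/
theorem pinOut_none_pinOut_some_almostExch (a b : ℕ → ℝ) (p : τ) :
    pinOut none (pinOut (some p) (almostExch a b : Finset (Option τ) → ℝ)) = freeW p b := by
  funext U
  rw [pinOut_apply, pinOut_apply, almostExch_apply, freeW_apply]
  by_cases hn : none ∈ U
  · rw [if_pos hn, if_pos (Or.inl hn)]
  · rw [if_neg hn]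
    by_cases hp : some p ∈ U
    · rw [if_pos hp, if_pos (Or.inr hp)]
    · rw [if_neg hp, if_neg hn, if_neg (by rw [not_or]; exact ⟨hn, hp⟩), Finset.card_eraseNone_of_not_mem hn]

/-- Shifting a profile against the blocks: `Σ_{k ≤ n} c_{k+1} E_k = Σ_{k ≤ n} c_k E'_k` with `E'_0 = 0`,
`E'_k = E_{k-1}` (`E_n = 0` over `n - 1` variables). [cite: BorceaBrandenLiggett2007, §6 proof of Prop. 6.2 (the
columns `Σ a_{j+1} e_j` of `CE`)] -/
theorem sum_succ_mul_esymmVal (p : τ) (c : ℕ → ℝ) (x : Option τ → ℝ) :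
    (∑ k ∈ range (Fintype.card τ + 1), c (k + 1) * ∑ W ∈ (Finset.univ.erase p).powersetCard k, ∏ j ∈ W, x (some j)) =
      ∑ k ∈ range (Fintype.card τ + 1), c k *
        (if k = 0 then 0 else ∑ W ∈ (Finset.univ.erase p).powersetCard (k - 1), ∏ j ∈ W, x (some j)) := by
  have hcard : (Finset.univ.erase p).card + 1 = Fintype.card τ := by
    rw [Finset.card_erase_of_mem (Finset.mem_univ p), Finset.card_univ]
    have := Fintype.card_pos_iff.2 ⟨p⟩
    omega
  rw [Finset.sum_range_succ, esymmVal_eq_zero_of_card_lt _ _ (by rw [← hcard]; exact Nat.lt_succ_self _), mul_zero,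
    add_zero, Finset.sum_range_succ']
  simp only [if_true, mul_zero, add_zero, Nat.succ_ne_zero, if_false, Nat.add_sub_cancel]

/-- **`Δ_{n+1,n}(g)(x) = A_0 B_1 - A_1 B_0 ≥ 0`** under (i)–(ii): the `TP₂ × TP₂` Cauchy–Binet step.
[cite: BorceaBrandenLiggett2007, §6 proof of Prop. 6.2 (display (6.1) and the `CE` argument)] -/
theorem eval_rayleighDiff_none_some_almostExch_nonneg {a b : ℕ → ℝ} (ha : ∀ k, 0 ≤ a k) (hb : ∀ k, 0 ≤ b k)
    (hab : IsLogConcaveSeq fun k => a k + b k) (hii : ∀ k, a (k + 1) * b k ≤ a k * b (k + 1))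
    {x : Option τ → ℝ} (hx : ∀ u, 0 ≤ x u) (p : τ) :
    0 ≤ MvPolynomial.eval x (rayleighDiff none (some p) (multiAffine (almostExch a b : Finset (Option τ) → ℝ))) := by
  rw [eval_rayleighDiff_multiAffine_eq_of_ne _ (Option.some_ne_none p).symm, pinOut_some_derivWeight_none_almostExch,
    pinOut_none_derivWeight_some_almostExch, derivWeight_none_derivWeight_some_almostExch,
    pinOut_none_pinOut_some_almostExch, eval_multiAffine_freeW, eval_multiAffine_freeW, eval_multiAffine_freeW,
    eval_multiAffine_freeW, sum_succ_mul_esymmVal p b, sum_succ_mul_esymmVal p a, sub_nonneg]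
  set E : ℕ → ℝ := fun k => ∑ W ∈ (Finset.univ.erase p).powersetCard k, ∏ j ∈ W, x (some j) with hE
  set E' : ℕ → ℝ := fun k => if k = 0 then 0 else E (k - 1) with hE'
  have hEpf : IsLogConcaveSeq E := isLogConcaveSeq_esymmVal _ fun j _ => hx (some j)
  have key := cauchyBinet_two_nonneg (Fintype.card τ + 1) (a := a) (b := b) (u := E) (v := E')
    (fun k l hkl => tp2_of_lc ha hb hab hii hkl) (fun k l hkl => by
      simp only [hE']
      rcases Nat.eq_zero_or_pos k with rfl | hk
      · rw [if_pos rfl, mul_zero]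
        exact mul_nonneg (hEpf.1 0) (by rw [if_neg (by omega)]; exact hEpf.1 _)
      · rw [if_neg (by omega), if_neg (by omega), mul_comm (E l)]
        exact hEpf.mul_le_mul (by omega) hkl.le (by omega))
  -- `key : (Σ a E')(Σ b E) ≤ (Σ a E)(Σ b E')`
  calc (∑ k ∈ range (Fintype.card τ + 1), a k * E' k) * ∑ k ∈ range (Fintype.card τ + 1), b k * E k
      ≤ (∑ k ∈ range (Fintype.card τ + 1), a k * E k) * ∑ k ∈ range (Fintype.card τ + 1), b k * E' k := key

end Blocks

/-! ## §3 Proposition 6.2 -/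

section Prop62

/-- `Δ_{ij}` of a weight is symmetric in `i, j`. [cite: BorceaBrandenLiggett2007, §2.1 Def. 2.5] -/
theorem eval_rayleighDiff_multiAffine_comm {σ : Type*} [Fintype σ] [DecidableEq σ] (μ : Finset σ → ℝ) (i j : σ)
    (x : σ → ℝ) :
    MvPolynomial.eval x (rayleighDiff i j (multiAffine μ)) = MvPolynomial.eval x (rayleighDiff j i (multiAffine μ)) := by
  rw [eval_rayleighDiff_multiAffine, eval_rayleighDiff_multiAffine, derivWeight_comm, mul_comm]

/-- **Borcea–Brändén–Liggett, Prop. 6.2 ("if")**: if (i) `{θ a_k + (1-θ) b_k}` is LC for all `θ ∈ [0,1]` and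
(ii) `a_k b_{k+1} ≥ a_{k+1} b_k`, then the almost exchangeable measure with profiles `a, b` is Rayleigh.
[cite: BorceaBrandenLiggett2007, §6 Prop. 6.2] -/
theorem isRayleigh_almostExch {a b : ℕ → ℝ}
    (hi : ∀ θ : ℝ, 0 ≤ θ → θ ≤ 1 → IsLogConcaveSeq fun k => θ * a k + (1 - θ) * b k)
    (hii : ∀ k, a (k + 1) * b k ≤ a k * b (k + 1)) :
    IsRayleigh (almostExch a b : Finset (Option τ) → ℝ) := by
  -- `a`, `b`, `a + b` are LC (θ = 1, 0, 1/2)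
  have hapf : IsLogConcaveSeq a := by
    have h := hi 1 zero_le_one le_rfl
    have heq : (fun k => (1 : ℝ) * a k + (1 - 1) * b k) = a := funext fun k => by ring
    rwa [heq] at h
  have hbpf : IsLogConcaveSeq b := by
    have h := hi 0 le_rfl zero_le_one
    have heq : (fun k => (0 : ℝ) * a k + (1 - 0) * b k) = b := funext fun k => by ring
    rwa [heq] at h
  have habpf : IsLogConcaveSeq fun k => a k + b k := by
    have h := isLogConcaveSeq_add_mul_of_convex hi zero_le_one
    have heq : (fun k => b k + (1 : ℝ) * a k) = fun k => a k + b k := funext fun k => by ring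
    rwa [heq] at h
  intro x hx i j
  rcases i with _ | p <;> rcases j with _ | q
  · -- `(n+1, n+1)`: a square
    rw [eval_rayleighDiff_multiAffine, derivWeight_derivWeight_self]
    have hz : multiAffine (0 : Finset (Option τ) → ℝ) = 0 := by simp [multiAffine]
    rw [hz, map_zero, zero_mul, sub_zero]
    exact mul_self_nonneg _
  · exact eval_rayleighDiff_none_some_almostExch_nonneg hapf.1 hbpf.1 habpf hii (fun u => (hx u).le) q
  · rw [eval_rayleighDiff_multiAffine_comm]
    exact eval_rayleighDiff_none_some_almostExch_nonneg hapf.1 hbpf.1 habpf hii (fun u => (hx u).le) p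
  · -- `(p, q)` with `p, q ≤ n`: the exchangeable case for the profile `b + x_{n+1} a`
    rw [eval_rayleighDiff_some_some, specNone_almostExch]
    exact isRayleigh_card (isLogConcaveSeq_add_mul_of_convex hi (hx none).le) _ (fun i => hx (some i)) p q

/-- The specialization of a Rayleigh weight at `t > 0` is Rayleigh. [cite: BorceaBrandenLiggett2007, §6 proof of
Prop. 6.2 ("By Proposition 2.1 … `g(z_1,…,z_n,θ/(1-θ))` is a Rayleigh polynomial")] -/
theorem isRayleigh_specNone {μ : Finset (Option τ) → ℝ} (h : IsRayleigh μ) {t : ℝ} (ht : 0 < t) :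
    IsRayleigh (specNone t μ) := by
  intro y hy p q
  have key := h (fun o => Option.elim o t y) (fun o => by cases o <;> simp [ht, hy]) (some p) (some q)
  rw [eval_rayleighDiff_some_some] at key
  exact key

/-- **Borcea–Brändén–Liggett, Prop. 6.2 ("only if")**: if the almost exchangeable measure with nonnegative
profiles `a, b` (vanishing above `n = |τ|`) is Rayleigh, then (i) `{θ a_k + (1-θ) b_k}` is LC for every
`θ ∈ [0,1]` and (ii) `a_k b_{k+1} ≥ a_{k+1} b_k`. [cite: BorceaBrandenLiggett2007, §6 Prop. 6.2] -/
theorem BorceaBrandenLiggett_prop_6_2_onlyIf {a b : ℕ → ℝ} (ha : ∀ k, 0 ≤ a k) (hb : ∀ k, 0 ≤ b k)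
    (ha0 : ∀ k, Fintype.card τ < k → a k = 0) (hb0 : ∀ k, Fintype.card τ < k → b k = 0)
    (h : IsRayleigh (almostExch a b : Finset (Option τ) → ℝ)) :
    (∀ θ : ℝ, 0 ≤ θ → θ ≤ 1 → IsLogConcaveSeq fun k => θ * a k + (1 - θ) * b k) ∧
      ∀ k, a (k + 1) * b k ≤ a k * b (k + 1) := by
  have h0 : ∀ U, 0 ≤ (almostExch a b : Finset (Option τ) → ℝ) U := almostExch_nonneg ha hb
  constructor
  · intro θ hθ0 hθ1
    -- a nonnegative exchangeable Rayleigh weight on `τ` with profile `c`, `c = θ a + (1-θ) b` up to a positive factor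
    -- on `k ≤ n`; the three cases `θ = 0`, `θ = 1`, `0 < θ < 1`
    have main : ∀ (c : ℕ → ℝ) (r : ℝ), 0 ≤ r → (∀ k, Fintype.card τ < k → θ * a k + (1 - θ) * b k = 0) →
        (∀ k, k ≤ Fintype.card τ → θ * a k + (1 - θ) * b k = r * c k) →
        IsRayleigh (fun S : Finset τ => c S.card) → (∀ S : Finset τ, 0 ≤ c S.card) →
        IsLogConcaveSeq fun k => θ * a k + (1 - θ) * b k := by
      intro c r hr hzero hc hR hc0
      obtain ⟨q, hq, hcq⟩ := ((isExchangeable_card c).isRayleigh_iff hc0).1 hR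
      have heq : (fun k => θ * a k + (1 - θ) * b k) = fun k => r * (if k ≤ Fintype.card τ then q k else 0) := by
        funext k
        by_cases hk : k ≤ Fintype.card τ
        · obtain ⟨S, -, hS⟩ := Finset.exists_subset_card_eq (s := (Finset.univ : Finset τ)) (n := k)
            (by rw [Finset.card_univ]; exact hk)
          rw [if_pos hk, hc k hk, ← hS, hcq S]
        · rw [if_neg hk, mul_zero, hzero k (not_le.1 hk)]
      rw [heq]
      exact (hq.truncLE _).const_mul hr
    rcases hθ1.lt_or_eq with hθ1' | rfl
    · rcases hθ0.lt_or_eq with hθ0' | rfl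
      · -- `0 < θ < 1`: `t = θ/(1-θ)`, profile `b + t a = (θ a + (1-θ) b)/(1-θ)`
        have h1θ : 0 < 1 - θ := by linarith
        set t := θ / (1 - θ) with ht
        have htpos : 0 < t := div_pos hθ0' h1θ
        refine main (fun k => b k + t * a k) (1 - θ) h1θ.le (fun k hk => by rw [ha0 k hk, hb0 k hk]; ring)
          (fun k _ => by rw [ht]; field_simp; ring) ?_ (fun S => add_nonneg (hb _) (mul_nonneg htpos.le (ha _)))
        rw [← specNone_almostExch]
        exact isRayleigh_specNone h htpos
      · -- `θ = 0`: profile `b` = specialization of the deletion `μ|_{z_{n+1} = 0}` at `t = 1`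
        refine main b 1 zero_le_one (fun k hk => by rw [hb0 k hk]; ring) (fun k _ => by ring) ?_ (fun S => hb _)
        have hspec : specNone 1 (pinOut none (almostExch a b : Finset (Option τ) → ℝ)) = fun S => b S.card := by
          funext S
          have hnone : (none : Option τ) ∉ S.map Function.Embedding.some := fun h' => by
            obtain ⟨y, _, hy⟩ := Finset.mem_map.1 h'
            exact Option.some_ne_none y hy
          rw [specNone_apply, pinOut_apply, pinOut_apply, if_neg hnone, if_pos (Finset.mem_insert_self _ _), mul_zero,
            add_zero, almostExch_apply, if_neg hnone, Finset.eraseNone_map_some]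
        rw [← hspec]
        exact isRayleigh_specNone (isRayleigh_pinOut h none) one_pos
    · -- `θ = 1`: profile `a` = specialization of `∂_{n+1} μ` at `t = 1`
      refine main a 1 zero_le_one (fun k hk => by rw [ha0 k hk]; ring) (fun k _ => by ring) ?_ (fun S => ha _)
      have hspec : specNone 1 (derivWeight none (almostExch a b : Finset (Option τ) → ℝ)) = fun S => a S.card := by
        funext S
        have hnone : (none : Option τ) ∉ S.map Function.Embedding.some := fun h' => by
          obtain ⟨y, _, hy⟩ := Finset.mem_map.1 h'
          exact Option.some_ne_none y hy
        rw [specNone_apply, derivWeight_apply, derivWeight_apply, if_neg hnone, if_pos (Finset.mem_insert_self _ _),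
          mul_zero, add_zero, almostExch_apply, if_pos (Finset.mem_insert_self _ _), eraseNone_insert_none,
          Finset.eraseNone_map_some]
      rw [← hspec]
      exact isRayleigh_specNone (isRayleigh_derivWeight h none) one_pos
  · -- (ii) from NLC at `S ∪ {n+1}`, `S ∪ {n}` for `S` a `k`-subset of `τ ∖ {p}`
    intro k
    by_cases hk : k + 1 ≤ Fintype.card τ
    · have hne : Nonempty τ := Fintype.card_pos_iff.1 (by omega)
      obtain ⟨p⟩ := hne
      obtain ⟨S, hSp, hS⟩ := Finset.exists_subset_card_eq (s := (Finset.univ : Finset τ).erase p) (n := k)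
        (by rw [Finset.card_erase_of_mem (Finset.mem_univ p), Finset.card_univ]; omega)
      have hpS : p ∉ S := fun h' => (Finset.mem_erase.1 (hSp h')).1 rfl
      set S' : Finset (Option τ) := S.map Function.Embedding.some with hS'
      have hnone : (none : Option τ) ∉ S' := fun h' => by
        obtain ⟨y, _, hy⟩ := Finset.mem_map.1 h'
        exact Option.some_ne_none y hy
      have hsp : some p ∉ S' := fun h' => hpS ((Finset.mem_map' _).1 h')
      have key := (h.isNLC h0) (insert none S') (insert (some p) S')
      have hU : insert none S' ∪ insert (some p) S' = insert none (insert (some p) S') := by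
        rw [Finset.insert_union, Finset.union_insert, Finset.union_self]
      have hI : insert none S' ∩ insert (some p) S' = S' := by
        rw [Finset.insert_inter_of_notMem (by rw [Finset.mem_insert, not_or]; exact ⟨(Option.some_ne_none p).symm, hnone⟩),
          Finset.inter_insert_of_notMem hsp, Finset.inter_self]
      rw [hU, hI, almostExch_apply, almostExch_apply, almostExch_apply, almostExch_apply,
        if_pos (Finset.mem_insert_self _ _), if_neg hnone, if_pos (Finset.mem_insert_self _ _),
        if_neg (by rw [Finset.mem_insert, not_or]; exact ⟨fun h' => Option.some_ne_none p h'.symm, hnone⟩),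
        eraseNone_insert_none, eraseNone_insert_none, hS', Finset.eraseNone_map_some] at key
      have h1 : (insert (some p) (S.map Function.Embedding.some)).eraseNone = insert p S := by
        ext y
        simp [Finset.mem_eraseNone]
      rw [h1, Finset.card_insert_of_notMem hpS, hS] at key
      linarith [key]
    · rw [ha0 (k + 1) (by omega), zero_mul]
      exact mul_nonneg (ha k) (hb _)

/-- **Borcea–Brändén–Liggett, Proposition 6.2.** For nonnegative profiles `a, b` vanishing above `n = |τ|`, the
almost exchangeable measure `z_{n+1} Σ a_k e_k + Σ b_k e_k` is Rayleigh iff (i) `{θ a_k + (1-θ) b_k}_k` is LC for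
all `θ ∈ [0,1]` and (ii) `a_k b_{k+1} ≥ a_{k+1} b_k` for all `k`. [cite: BorceaBrandenLiggett2007, §6 Prop. 6.2] -/
theorem BorceaBrandenLiggett_prop_6_2 {a b : ℕ → ℝ} (ha : ∀ k, 0 ≤ a k) (hb : ∀ k, 0 ≤ b k)
    (ha0 : ∀ k, Fintype.card τ < k → a k = 0) (hb0 : ∀ k, Fintype.card τ < k → b k = 0) :
    IsRayleigh (almostExch a b : Finset (Option τ) → ℝ) ↔
      (∀ θ : ℝ, 0 ≤ θ → θ ≤ 1 → IsLogConcaveSeq fun k => θ * a k + (1 - θ) * b k) ∧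
        ∀ k, a (k + 1) * b k ≤ a k * b (k + 1) :=
  ⟨BorceaBrandenLiggett_prop_6_2_onlyIf ha hb ha0 hb0, fun h => isRayleigh_almostExch h.1 h.2⟩

end Prop62

end Literature.Probability.NegativeDependence

end
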